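import Summits.CriticalPhenomena.CardyFormulaZ2.Theorems.CardyUniqueLimitCardyRigiditySlitCrossingClockAssembly
import Summits.CriticalPhenomena.CardyFormulaZ2.Theorems.CardyUniqueLimitCardyRigidityCapacityClockSteps
import Literature.Probability.LatticeModels.FKExplorationClock
import HarnessLib

/-!
# The capacity clock of the bond-`ℤ²` exploration: horizon form, cut of the clock form, and the
# clock at one scale

Crux `Summit.CriticalPhenomena.CardyFormulaZ2.Theses.CardyUniqueLimit.CardyRigidity`
(stmt-CriticalPhenomena-0746), line `crossing_martingale`, stub A3a `stub_percCapacityClock`.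

The registered predicate `PercCapacityClock` (`…SlitCrossingClockAssembly.lean`) asks, off the
bad event, for the identification "`θ_n` is the capacity time of `γ[0, n+1]`" at EVERY step
`n ≤ M_k` (and increments `≤ Δ_k` at every `n < M_k`), while `V^k_u` must be
`𝒢_{M_k}`-measurable for ALL `u` and `𝒢` must compute conditional expectations as the slit
expectations of the prefix.  These clauses are jointly unsatisfiable for a genuine exploration:
the last two force the whole driving function to be an a.s. function of the first `M_k + 2`
vertices, whereas at a step where the prefix is the whole interface — whose trace contains
`b_k = Φ_k(∞)`, a value `Φ_k` does not take on the closed half-plane — no finite capacity time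
exists, so off `bad` the exploration would have to be unfinished at step `M_k` with an a.s.
forced continuation.  The consumer `percCrossingClockForm_of` only uses the identification at
steps with `θ_n ≤ t + Δ_k`.  Hence:

* `PercCapacityClockH` — the HORIZON FORM: verbatim `PercCapacityClock` except that the
  identification is required only while `θ_n < t + 1` (the clock may be frozen at the cap
  `t + 1`, as in `PercParaClockData` of crux stmt-11389);
* `capClock_percCrossingClockForm_ofH` — the cut re-proved:
  `PercCapacityClockH → PercSlitObservableApprox f → PercCrossingClockForm f`;
* namespace `CapacityClock`, one scale (`rep`, `clock`): the capped capacity clock read on a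
  describable representative of the prefix class — a sure class function of the prefix — with
  its identification below the cap, the locality of the driving values below the clock
  (`IsLoewnerDescribed.eqOn_of_eqOn`), and its value `L` at the sure step bound
  (`…CapacityClockSteps.lean` for the lattice/Loewner facts); the proof of `PercCapacityClockH`
  is `…StubPercCapacityClock.lean`.
-/

noncomputable section

open MeasureTheory Filter Set Topology Metric
open scoped NNReal ENNReal unitInterval
open UpperHalfPlane (upperHalfPlaneSet)
open Literature.Probability Literature.Probability.RandomPlanarGeometry
  Literature.Probability.LatticeModels Literature.Probability.LatticeModels.DiscreteDobrushin
open Literature.Probability.Percolation (bondDomainCrossingProb bondInterfaceIn BondConfig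
  bondPercolation half measurable_bondInterfaceIn)
open scoped Literature.Probability.RandomPlanarGeometry.PathBorel
open Summit.CriticalPhenomena.CardyFormulaZ2.Cruxes.ParafermionToSLESixFamilies.CaratheodoryNetSlitUniformity
  (percSlitExpectation condExp_explorationFiltration_ae_eq_percSlitExpectation)

namespace Summit.CriticalPhenomena.CardyFormulaZ2.Cruxes.CardyRigidity.CrossingMartingale

/-- **(P-clock, horizon form) Capacity clocks of the bond-`ℤ²` exploration.**  Verbatim
`PercCapacityClock` except for the last clause: off `bad` the interface is describable through
`φ_k` and `θ_n` IS the capacity time of the explored piece `γ[0, n+1]` for every `n ≤ M_k` WITH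
`θ_n < t + 1` (the clock may be frozen at `t + 1` beyond the horizon; at the step where the
exploration is complete no finite capacity time exists).
(Sources: Camia–Newman 2007, §5; Kemppainen–Smirnov 2017; Duminil-Copin–Smirnov 2012,
Prop. 6.7.  A sub-goal of the crux, stated as a predicate of this route — deliberately NOT a
cited Literature fact.) -/
def PercCapacityClockH : Prop :=
    ∀ (D : DobrushinDomain) (E : ℝ → DiscreteDobrushin), ZdDiscretisationFamily D E →
    ∀ φ : ConformalEquiv upperHalfPlaneSet D.carrier, D.IsChordalUniformizing φ →
    ∀ δs : ℕ → ℝ, (∀ k, 0 < δs k) → Tendsto δs atTop (𝓝 0) →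
      ∀ hδadm : ∀ k, (E (δs k)).IsZdAdmissible,
      (∀ᶠ k in atTop, ∀ ω, bondInterfaceIn D (E (δs k)) ω =
        CurveClass.mk ⟨medialExplorationCurve (E (δs k)) ω⟩) →
    ∀ (Ds : ℕ → DobrushinDomain) (φs : ∀ k, ConformalEquiv upperHalfPlaneSet (Ds k).carrier),
      (∀ k, (Ds k).IsChordalUniformizing (φs k)) →
      (∀ R : ℝ, TendstoUniformlyOn (fun k ↦ (φs k).boundaryExtension) φ.boundaryExtension
        atTop ({z : ℂ | 0 ≤ z.im} ∩ closedBall 0 R)) →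
      (∀ ε : ℝ, 0 < ε → ∃ r : ℝ, ∀ᶠ k in atTop, ∀ z : ℂ, z ∈ {z : ℂ | 0 ≤ z.im} → r ≤ ‖z‖ →
        dist ((φs k).boundaryExtension z) ((Ds k).pt 1) ≤ ε) →
      Tendsto (fun k ↦ (Ds k).pt 1) atTop (𝓝 (D.pt 1)) →
      (∀ ε : ℝ≥0∞, 0 < ε → ∃ (δγ δW : ℕ → ℝ) (T : ℕ → ℝ≥0), (∀ j, 0 < δγ j) ∧
        (∀ j, 0 < δW j) ∧
        ∀ k, bondPercolation (zdGraph 2) half ((bondInterfaceIn D (E (δs k))) ⁻¹'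
          ((fun p ↦ compactifiedClass (φs k).boundaryExtension ((Ds k).pt 1) p.1) ''
            {p : C(ℝ≥0, ℂ) × C(ℝ≥0, ℝ) | p ∈ generatedPairs ∧
              p.1 ∈ Process.modulusSet ({0} : Set ℂ) δγ ∧
              p.2 ∈ Process.modulusSet ({0} : Set ℝ) δW ∧
              ∀ (j : ℕ) (t : ℝ≥0), T j ≤ t → (j : ℝ) ≤ ‖p.1 t‖})ᶜ) ≤ ε) →
    ∀ t : ℝ≥0,
      ∃ Δ η : ℕ → ℝ≥0, Tendsto Δ atTop (𝓝 0) ∧ Tendsto η atTop (𝓝 0) ∧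
        ∀ᶠ k in atTop, ∃ (𝒢 : Filtration ℕ (inferInstance : MeasurableSpace (BondConfig (Site 2))))
          (θ : ℕ → BondConfig (Site 2) → ℝ≥0) (Mk : ℕ) (bad : Set (BondConfig (Site 2))),
          (∀ g : BondConfig (Site 2) → ℝ, StronglyMeasurable g → (∀ ω, |g ω| ≤ 1) → ∀ n,
            (bondPercolation (zdGraph 2) half)[g|𝒢 n] =ᵐ[bondPercolation (zdGraph 2) half]
              percSlitExpectation (hδadm k) half n g) ∧
          Adapted 𝒢 θ ∧ (∀ ω, ω ∉ bad → θ 0 ω ≤ Δ k) ∧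
          (∀ u, Measurable[𝒢 Mk] fun ω ↦
            -drivingFunction (φs k) (bondInterfaceIn D (E (δs k)) ω) u) ∧
          (∀ n u, Measurable[𝒢 n] ({ω | u ≤ θ n ω}.indicator fun ω ↦
            -drivingFunction (φs k) (bondInterfaceIn D (E (δs k)) ω) u)) ∧
          MeasurableSet bad ∧ bondPercolation (zdGraph 2) half bad ≤ η k ∧
          (∀ ω, ω ∉ bad → ∃ n ≤ Mk, t ≤ θ n ω) ∧
          (∀ ω, ω ∉ bad → ∀ n, n < Mk → θ (n + 1) ω ≤ θ n ω + Δ k) ∧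
          (∀ ω, ω ∉ bad → IsLoewnerDescribable (φs k) (bondInterfaceIn D (E (δs k)) ω) ∧
            ∀ n, n ≤ Mk → (θ n ω : ℝ) < t + 1 → (φs k).boundaryExtension ''
              (Loewner.trace (drivingFunction (φs k) (bondInterfaceIn D (E (δs k)) ω)) ''
                Icc 0 (θ n ω)) =
              range (polyline ((explorationPrefix (E (δs k)) n ω).map (medialPoint (E (δs k)).δ))))

/-- **The cut of the clock form, horizon version** (registered glue): a horizon capacity clock
and the slit-observable estimate give the clock form of STUB A3 (same proof as
`percCrossingClockForm_of`; the identification is only invoked at steps with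
`θ_n ≤ t + Δ_k < t + 1`). [cite: CamiaNewman2007, §5] -/
theorem capClock_percCrossingClockForm_ofH : ∀ {f : ℝ → ℝ}, PercCapacityClockH → PercSlitObservableApprox f → PercCrossingClockForm f := by
  intro f h1 h2 D E hE φ hφ δs hδpos hδ0 hδadm hor Ds φs hφs hU1 hU2 hb hbox x m M d hx s t hst
  obtain ⟨Δ, η₁, hΔ, hη₁, hev₁⟩ := h1 D E hE φ hφ δs hδpos hδ0 hδadm hor Ds φs hφs hU1 hU2 hb hbox t
  obtain ⟨ε, η₂, hε, hη₂, hev₂⟩ :=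
    h2 D E hE φ hφ δs hδpos hδ0 hδadm hor Ds φs hφs hU1 hU2 hb hbox x m M d hx (t + 1)
  have hΔ1 : ∀ᶠ k in atTop, Δ k < 1 := hΔ.eventually_lt_const zero_lt_one
  refine ⟨ε, Δ, fun k ↦ η₁ k + η₂ k, hε, hΔ, by simpa using hη₁.add hη₂, ?_⟩
  filter_upwards [hev₁, hev₂, hΔ1] with k hk₁ hk₂ hk₃
  obtain ⟨𝒢, θ, Mk, bad₁, hbridge, hθ, hθ0, hVM, hVloc, hbad₁, hPbad₁, hreach, hincr, hid⟩ := hk₁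
  obtain ⟨X, bad₂, hXm, hX1, hbad₂, hPbad₂, happ⟩ := hk₂
  set P := bondPercolation (zdGraph 2) half with hP
  refine ⟨𝒢, θ, Mk, X, bad₁ ∪ bad₂, hθ,
    fun ω hω ↦ hθ0 ω fun h ↦ hω (Or.inl h), hVM, hVloc, Eventually.of_forall hX1,
    hbad₁.union hbad₂, ?_, fun ω hω ↦ hreach ω fun h ↦ hω (Or.inl h),
    fun ω hω ↦ hincr ω fun h ↦ hω (Or.inl h), ?_⟩
  · calc P (bad₁ ∪ bad₂) ≤ P bad₁ + P bad₂ := measure_union_le _ _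
      _ ≤ η₁ k + η₂ k := add_le_add hPbad₁ hPbad₂
      _ = ((η₁ k + η₂ k : ℝ≥0) : ℝ≥0∞) := (ENNReal.coe_add _ _).symm
  · -- `E[X | 𝒢_n] = percSlitExpectation … n X` a.e., for all `n`
    have hce : ∀ᵐ ω ∂P, ∀ n : ℕ, (P[X|𝒢 n]) ω = percSlitExpectation (hδadm k) half n X ω := by
      rw [ae_all_iff]
      intro n
      exact hbridge X hXm hX1 n
    filter_upwards [hce] with ω hω hωbad n hn hθn
    rw [hω n]
    obtain ⟨hdesc, hidn⟩ := hid ω fun h ↦ hωbad (Or.inl h)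
    have hlt : (θ n ω : ℝ) < t + 1 := by
      have h1 : ((θ n ω : ℝ≥0) : ℝ) ≤ t + Δ k := by exact_mod_cast hθn
      have h2 : ((Δ k : ℝ≥0) : ℝ) < 1 := by exact_mod_cast hk₃
      linarith
    refine happ ω (fun h ↦ hωbad (Or.inr h)) n (θ n ω) hdesc (hidn n hn hlt) ?_
    calc θ n ω ≤ t + Δ k := hθn
      _ ≤ t + 1 := add_le_add le_rfl hk₃.le

namespace CapacityClock

/-! ### One scale: the representative, the clock, class-function properties -/

section Scale

variable {E : DiscreteDobrushin} {D D' : DobrushinDomain}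
  {φ' : ConformalEquiv upperHalfPlaneSet D'.carrier}

/-- A representative of the prefix class of `ω` at depth `n` whose interface is describable
through `φ'` (when there is one; junk otherwise). [cite: DuminilCopinSmirnov2012Clay, §6.2, Lemma 6.6] -/
def rep (D : DobrushinDomain) (E : DiscreteDobrushin)
    (φ' : ConformalEquiv upperHalfPlaneSet D'.carrier) (n : ℕ) (ω : BondConfig (Site 2)) :
    BondConfig (Site 2) :=
  Classical.epsilon fun ω' ↦ explorationPrefix E n ω' = explorationPrefix E n ω ∧
    IsLoewnerDescribable φ' (bondInterfaceIn D E ω')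

open scoped Classical in
/-- **The capacity clock**, frozen at the cap `L`: `min (T_n, L)` for the capacity time `T_n`
of the explored piece `γ[0, n+1]` of the describable representative of the prefix class — a
sure function of the prefix —, and `L` when no capacity time exists.
[cite: DuminilCopinSmirnov2012Clay, Prop. 6.7 (proof, p. 29)] -/
def clock (D : DobrushinDomain) (E : DiscreteDobrushin)
    (φ' : ConformalEquiv upperHalfPlaneSet D'.carrier) (L : ℝ≥0) (n : ℕ)
    (ω : BondConfig (Site 2)) : ℝ≥0 :=
  if h : ∃ T : ℝ≥0, φ'.boundaryExtension ''
      (Loewner.trace (drivingFunction φ' (bondInterfaceIn D E (rep D E φ' n ω))) '' Icc 0 T) =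
      range (polyline ((explorationPrefix E n (rep D E φ' n ω)).map (medialPoint E.δ)))
  then min h.choose L else L

/-- The clock never exceeds its cap. [folklore] -/
theorem clock_le (L : ℝ≥0) (n : ℕ) (ω : BondConfig (Site 2)) : clock D E φ' L n ω ≤ L := by
  unfold clock
  split_ifs
  · exact min_le_right _ _
  · exact le_rfl

/-- The representative is a function of the prefix. [cite: DuminilCopinSmirnov2012Clay, §6.2, Lemma 6.6] -/
theorem rep_eq_of_prefix_eq {n : ℕ} {ω ω₀ : BondConfig (Site 2)}
    (h : explorationPrefix E n ω = explorationPrefix E n ω₀) :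
    rep D E φ' n ω = rep D E φ' n ω₀ := by
  unfold rep
  rw [h]

/-- The clock is a function of the prefix. [cite: DuminilCopinSmirnov2012Clay, Prop. 6.7 (proof, p. 29)] -/
theorem clock_eq_of_prefix_eq (L : ℝ≥0) {n : ℕ} {ω ω₀ : BondConfig (Site 2)}
    (h : explorationPrefix E n ω = explorationPrefix E n ω₀) :
    clock D E φ' L n ω = clock D E φ' L n ω₀ := by
  unfold clock
  rw [rep_eq_of_prefix_eq h]

/-- For a describable configuration the representative has the same prefix and is describable.
[folklore] -/
theorem rep_spec {n : ℕ} {ω : BondConfig (Site 2)}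
    (hω : IsLoewnerDescribable φ' (bondInterfaceIn D E ω)) :
    explorationPrefix E n (rep D E φ' n ω) = explorationPrefix E n ω ∧
      IsLoewnerDescribable φ' (bondInterfaceIn D E (rep D E φ' n ω)) :=
  Classical.epsilon_spec (p := fun ω' ↦ explorationPrefix E n ω' = explorationPrefix E n ω ∧
    IsLoewnerDescribable φ' (bondInterfaceIn D E ω')) ⟨ω, rfl, hω⟩

variable (hor : ∀ ω, bondInterfaceIn D E ω =
    CurveClass.mk ⟨polyline ((medialExploration E ω).map (medialPoint E.δ))⟩)
include hor

/-- Under the orientation hypothesis a describable interface is the polyline class described by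
its driving function. [cite: Lawler2005, §4.1] -/
theorem described_of {ω : BondConfig (Site 2)} (hω : IsLoewnerDescribable φ' (bondInterfaceIn D E ω)) :
    IsLoewnerDescribed φ' (CurveClass.mk ⟨polyline ((medialExploration E ω).map (medialPoint E.δ))⟩)
      (drivingFunction φ' (bondInterfaceIn D E ω)) := by
  have h := isLoewnerDescribed_drivingFunction hω
  rwa [hor ω] at h ⊢

/-- A describable interface is a genuine exploration path (not the junk `[]`: the junk constant
curve `0` would put `b'` at `Φ(γ̂ 0)`). [cite: Smirnov2001, §2] -/
theorem isMedialExploration_of (hφ' : D'.IsChordalUniformizing φ') {ω : BondConfig (Site 2)}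
    (hω : IsLoewnerDescribable φ' (bondInterfaceIn D E ω)) :
    IsMedialExploration E ω (medialExploration E ω) := by
  rcases medialExploration_eq_nil_or E ω with hnil | h
  · exfalso
    have hd := described_of hor hω
    have h1 := pt_one_mem_range hd
    have h0 := apply_zero_eq hd
    rw [hnil, List.map_nil, polyline_nil] at h1 h0
    obtain ⟨s, hs⟩ := h1
    rw [ContinuousMap.const_apply] at hs h0
    exact MarkedDomain.boundaryExtension_ne_pt_one JordanDomain.exists_continuousOn_extension_holds
      hφ' (hd.exists_eq_mk_trace.1.im_nonneg 0) (h0 ▸ hs)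
  · exact h

variable (hE : E.IsZdAdmissible) (hφ' : D'.IsChordalUniformizing φ')
include hE hφ'

/-- **The capacity identity is a class function of the prefix among describable
configurations** (`IsLoewnerDescribed.image_trace_eq_of_eqOn` with the agreement of the
polylines up to the prefix time). [cite: DuminilCopinSmirnov2012Clay, Prop. 6.7 (proof, p. 29)] -/
theorem hasCap_of_prefix_eq {n : ℕ} {ω ω' : BondConfig (Site 2)}
    (hω : IsLoewnerDescribable φ' (bondInterfaceIn D E ω))
    (hω' : IsLoewnerDescribable φ' (bondInterfaceIn D E ω'))
    (hpre : explorationPrefix E n ω' = explorationPrefix E n ω) {T : ℝ≥0}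
    (hT : φ'.boundaryExtension '' (Loewner.trace (drivingFunction φ' (bondInterfaceIn D E ω)) ''
      Icc 0 T) = range (polyline ((explorationPrefix E n ω).map (medialPoint E.δ)))) :
    φ'.boundaryExtension '' (Loewner.trace (drivingFunction φ' (bondInterfaceIn D E ω')) ''
      Icc 0 T) = range (polyline ((explorationPrefix E n ω').map (medialPoint E.δ))) := by
  have hcyl : ω' ∈ explorationCylinder hE ω n := by
    rw [explorationCylinder_eq_preimage_explorationPrefix]
    exact hpre
  have heq := eqOn_polyline_map_of_mem_explorationCylinder (medialPoint E.δ) hcyl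
  rw [← image_Iic_polyline_map_eq_range_prefix (medialPoint E.δ) n ω] at hT
  rw [← image_Iic_polyline_map_eq_range_prefix (medialPoint E.δ) n ω']
  exact (described_of hor hω).image_trace_eq_of_eqOn hφ' (described_of hor hω') heq.symm hT

omit hE hφ' in
/-- Capacity times are unique. [cite: Lawler2005, Ch. 4 §4.1 Thm. 4.6] -/
theorem capTime_unique {n : ℕ} {ω : BondConfig (Site 2)}
    (hω : IsLoewnerDescribable φ' (bondInterfaceIn D E ω)) {T T' : ℝ≥0}
    (hT : φ'.boundaryExtension '' (Loewner.trace (drivingFunction φ' (bondInterfaceIn D E ω)) ''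
      Icc 0 T) = range (polyline ((explorationPrefix E n ω).map (medialPoint E.δ))))
    (hT' : φ'.boundaryExtension '' (Loewner.trace (drivingFunction φ' (bondInterfaceIn D E ω)) ''
      Icc 0 T') = range (polyline ((explorationPrefix E n ω).map (medialPoint E.δ)))) :
    T = T' :=
  (described_of hor hω).eq_of_image_trace_eq (hT.trans hT'.symm)

/-- **The clock of a describable configuration with a capacity time** is `min (T_n, L)`.
[cite: DuminilCopinSmirnov2012Clay, Prop. 6.7 (proof, p. 29)] -/
theorem clock_eq_min (L : ℝ≥0) {n : ℕ} {ω : BondConfig (Site 2)}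
    (hω : IsLoewnerDescribable φ' (bondInterfaceIn D E ω)) {T : ℝ≥0}
    (hT : φ'.boundaryExtension '' (Loewner.trace (drivingFunction φ' (bondInterfaceIn D E ω)) ''
      Icc 0 T) = range (polyline ((explorationPrefix E n ω).map (medialPoint E.δ)))) :
    clock D E φ' L n ω = min T L := by
  obtain ⟨hpre, hrep⟩ := rep_spec (D := D) (E := E) (φ' := φ') (n := n) hω
  have hex : ∃ T' : ℝ≥0, φ'.boundaryExtension ''
      (Loewner.trace (drivingFunction φ' (bondInterfaceIn D E (rep D E φ' n ω))) '' Icc 0 T') =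
      range (polyline ((explorationPrefix E n (rep D E φ' n ω)).map (medialPoint E.δ))) :=
    ⟨T, hasCap_of_prefix_eq hor hE hφ' hω hrep hpre hT⟩
  unfold clock
  rw [dif_pos hex]
  congr 1
  have h1 := hasCap_of_prefix_eq hor hE hφ' hrep hω hpre.symm hex.choose_spec
  exact capTime_unique hor hω h1 hT

/-- **The clock of a describable configuration without a capacity time** is the cap `L`.
[cite: DuminilCopinSmirnov2012Clay, Prop. 6.7 (proof, p. 29)] -/
theorem clock_eq_cap (L : ℝ≥0) {n : ℕ} {ω : BondConfig (Site 2)}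
    (hω : IsLoewnerDescribable φ' (bondInterfaceIn D E ω))
    (hno : ¬ ∃ T : ℝ≥0, φ'.boundaryExtension ''
      (Loewner.trace (drivingFunction φ' (bondInterfaceIn D E ω)) '' Icc 0 T) =
      range (polyline ((explorationPrefix E n ω).map (medialPoint E.δ)))) :
    clock D E φ' L n ω = L := by
  obtain ⟨hpre, hrep⟩ := rep_spec (D := D) (E := E) (φ' := φ') (n := n) hω
  unfold clock
  rw [dif_neg]
  rintro ⟨T', hT'⟩
  exact hno ⟨T', hasCap_of_prefix_eq hor hE hφ' hrep hω hpre.symm hT'⟩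

/-- **Identification below the cap**: if `θ_n < L` then `θ_n` IS the capacity time of
`γ[0, n+1]`. [cite: DuminilCopinSmirnov2012Clay, Prop. 6.7 (proof, p. 29)] -/
theorem hasCap_clock_of_lt (L : ℝ≥0) {n : ℕ} {ω : BondConfig (Site 2)}
    (hω : IsLoewnerDescribable φ' (bondInterfaceIn D E ω)) (hlt : clock D E φ' L n ω < L) :
    φ'.boundaryExtension '' (Loewner.trace (drivingFunction φ' (bondInterfaceIn D E ω)) ''
      Icc 0 (clock D E φ' L n ω)) = range (polyline ((explorationPrefix E n ω).map (medialPoint E.δ))) := by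
  by_cases hex : ∃ T : ℝ≥0, φ'.boundaryExtension ''
      (Loewner.trace (drivingFunction φ' (bondInterfaceIn D E ω)) '' Icc 0 T) =
      range (polyline ((explorationPrefix E n ω).map (medialPoint E.δ)))
  · obtain ⟨T, hT⟩ := hex
    have h := clock_eq_min hor hE hφ' L hω hT
    rw [h] at hlt ⊢
    rcases lt_or_ge T L with hTL | hTL
    · rw [min_eq_left hTL.le]; exact hT
    · rw [min_eq_right hTL] at hlt; exact (lt_irrefl _ hlt).elim
  · rw [clock_eq_cap hor hE hφ' L hω hex] at hlt
    exact (lt_irrefl _ hlt).elim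

/-- **Locality of the driving values below the clock**: for a describable `ω` and `u ≤ θ_n(ω)`,
the driving function of `ω` at `u` equals that of the representative of its prefix class
(`IsLoewnerDescribed.eqOn_of_eqOn`; when no capacity time exists the prefix trace is the whole
interface, `CapacityClock.image_trace_subset_image_Iic`).
[cite: DuminilCopinSmirnov2012Clay, Prop. 6.7 (proof, p. 29)] -/
theorem drivingFunction_eq_rep (L : ℝ≥0) {n : ℕ} {ω : BondConfig (Site 2)}
    (hω : IsLoewnerDescribable φ' (bondInterfaceIn D E ω)) {u : ℝ≥0}
    (hu : u ≤ clock D E φ' L n ω) :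
    drivingFunction φ' (bondInterfaceIn D E ω) u =
      drivingFunction φ' (bondInterfaceIn D E (rep D E φ' n ω)) u := by
  obtain ⟨hpre, hrep⟩ := rep_spec (D := D) (E := E) (φ' := φ') (n := n) hω
  have hcyl : rep D E φ' n ω ∈ explorationCylinder hE ω n := by
    rw [explorationCylinder_eq_preimage_explorationPrefix]
    exact hpre
  have heq := eqOn_polyline_map_of_mem_explorationCylinder (medialPoint E.δ) hcyl
  refine (described_of hor hω).eqOn_of_eqOn hφ' (described_of hor hrep) heq.symm (T := u) ?_
    ⟨zero_le, le_rfl⟩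
  change φ'.boundaryExtension '' _ ⊆ polyline ((medialExploration E ω).map (medialPoint E.δ)) '' _
  refine image_trace_subset_image_Iic hφ' (described_of hor hω) fun T hT ↦ ?_
  rw [image_Iic_polyline_map_eq_range_prefix] at hT
  rw [clock_eq_min hor hE hφ' L hω hT] at hu
  exact hu.trans (min_le_left _ _)

/-- **At the sure step bound the clock is at its cap**: once the prefix is the whole interface,
whose trace contains `b'`, no capacity time exists. [cite: Smirnov2001, §2] -/
theorem clock_card_eq (L : ℝ≥0) {ω : BondConfig (Site 2)}
    (hω : IsLoewnerDescribable φ' (bondInterfaceIn D E ω)) :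
    clock D E φ' L (finite_innerCorners hE).toFinset.card ω = L := by
  refine clock_eq_cap hor hE hφ' L hω ?_
  rintro ⟨T, hT⟩
  rw [explorationPrefix_eq_self hE ((exitTime_le_card_innerCorners hE ω).trans (Nat.le_succ _))]
    at hT
  exact image_trace_ne_range hφ' (described_of hor hω) T hT

end Scale

end CapacityClock

end Summit.CriticalPhenomena.CardyFormulaZ2.Cruxes.CardyRigidity.CrossingMartingale

end
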